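import Literature.InformationTheory.QuantumCodes.QuantumExpanderRobustnessProjection
import Literature.InformationTheory.QuantumCodes.QuantumExpanderSmallSetFlipMinMax
import HarnessLib

/-!
# Small-set-flip with a NOISY syndrome (Fawzi–Grospellier–Leverrier, FOCS 2018, §3.3 "Small adversarial
# errors"), part 1: Lemma 17, Lemma 18, the critical decomposition `E₀ = ⊎ Fᵢ`, and Lemma 15 (Robustness) — PROOF

Index of sources: `[cite: FawziGrospellierLeverrier2018FT]` = O. Fawzi, A. Grospellier, A. Leverrier, *Constant
overhead quantum fault-tolerance with quantum expander codes*, FOCS 2018, arXiv:1808.03821 (held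
`paper:arxiv-1808.03821`): §3.1 Notations (p0016: `β₀ = 1 − 8δ`, `β₁ = 1 − 16δ`, `γ₀`, `c₀, c₁, c₂`), §3.3 (p0016 L75 –
p0018: Prop. 14, Lemma 15 "Robustness", Cor. 16, the normalized weight `‖E‖ = |E ∩ A²|/d_B + |E ∩ B²|/d_A`, Lemma 17,
Lemma 18 "Lemma 8 of [LTZ15] revisited", and the common beginning of the proofs of Prop. 14 / Lemma 15: the
decomposition `E₀ = ⊎ᵢ Fᵢ` with eq. (rewrite sigma)); `[cite: FawziGrospellierLeverrier2018]` = the STOC 2018 companion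
arXiv:1711.08351v2, Lemma 24 (§7.1, p0018) — the same `‖·‖`; `[cite: LeverrierTillichZemor2015]` = arXiv:1504.00822v1,
Lemma 7 (critical generators).

Topic `Literature/InformationTheory/QuantumCodes` (venture QEC, row 04 `prover-qec-type-04` gen 8, line L-SSF-NOISY).
Objects are the tree's (`QuantumExpanderCodes.lean`, `QuantumExpanderCriticalGenerators.lean`): `H : Matrix B A (ZMod 2)`
the biadjacency matrix of `G`, `IsBiregular H Δ_A Δ_B`, `IsLeftRightExpanding H Δ_A Δ_B γ_A δ γ_B δ` (the paper has one
`δ`), qubits `(A × A) ⊕ (B × B)`, `σ_X = expanderHX H *ᵥ ·`, generators = rows of `expanderHZ H`, `smallSets`,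
`syndromeDecrease` (`Δ(σ, F) = |σ| − |σ ⊕ σ_X(F)|`), `flipVec` (`𝟙_F`), `wnorm Δ_A Δ_B e = Δ_A|E ∩ A²| + Δ_B|E ∩ B²|`
(`= d_A d_B ‖E‖`), `critFlip` (`x_a ⊎ x_b`), `critX`/`critY` (index sets of `x_a`, `x_b`). DICTIONARY for the paper's
degree convention `d_A ≤ d_B`: every printed `d_A` that is "the smaller degree" is `min Δ_A Δ_B` here, and the printed
radius `|E| ≤ γ₀√n` (`γ₀ = r²γ/√(1+r²)`, `r = d_A/d_B`, `n = n_A² + n_B²`, `n_A d_A = n_B d_B`) — which the paper uses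
only through "`|E| ≤ d_B‖E‖ ≤ γ₀√n/r = min(γ n_A, γ n_B)`" (proof of Lemma 18, p0017 L60-66) — is rendered as the
hypothesis `max Δ·|E| ≤ min Δ·min(γ_A n_A, γ_B n_B)` (or directly on `wnorm`). "Reduced" (`|·|`-minimal in
`E + C_Z^⊥`) and "`‖·‖`-reduced" are spelled out as hypotheses; no definition is introduced.

* `wnorm_add_add_two_mul_winter`, `wnorm_le_wnorm_add_of_subset`, `hammingNorm_le_hammingNorm_add_of_subset` —
  **Lemma 17** (a subset of a reduced / `‖·‖`-reduced error is reduced / `‖·‖`-reduced), vector form;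
* `hammingNorm_syndrome_critFlip` — `|σ_X(x_a ⊎ x_b)| + 2|x_a||x_b| = Δ_AΔ_B‖x_a ⊎ x_b‖` (eq. (func analysis));
* `fgl18b_lemma18` — **Lemma 18** at a critical generator with the local minimality inequality
  `Δ_A|x_a| + Δ_B|x_b| ≤ Δ_AΔ_B` ("`‖x_a‖ + ‖x_b‖ ≤ 1` because `E` is `‖·‖`-reduced"): `F = x_a ⊎ x_b ⊆ E` is a small
  set with (i) `|σ_X(F)| ≥ ½ Δ_AΔ_B‖F‖` and (ii) `Δ(σ_X(E), F) ≥ |σ_X(F)| − 4δ Δ_AΔ_B‖F‖`;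
* `exists_critical_decomposition` — the common beginning of the two proofs: a `‖·‖`-reduced `E₀` with
  `|E₀| ≤ min(γ_A n_A, γ_B n_B)` is a disjoint union of such flips, with eq. (rewrite sigma)
  `|σ_X(E₀)| ≥ Σᵢ (|σ_X(Fᵢ)| − 4δ Δ_AΔ_B‖Fᵢ‖)`, `Σᵢ Δ_AΔ_B‖Fᵢ‖ = Δ_AΔ_B‖E₀‖`, `σ_X(E₀) = Σᵢ σ_X(Fᵢ)`;
* ★ `fgl18b_lemma15` — **Lemma 15 (Robustness)**: a reduced `E_R` with `max Δ·|E_R| ≤ min Δ·min(γ_A n_A, γ_B n_B)`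
  has `|σ_X(E_R)| ≥ (β₀·min Δ/2)|E_R|`, `β₀ = 1 − 8δ` (printed: `(β₀ d_A/2)|E_R|` for `|E_R| ≤ γ₀√n`).

Column word: PROVED (kernel), statements as printed modulo the dictionary above; no definitions, no named facts.
Part 2 (`QuantumExpanderNoisySyndrome.lean`): Prop. 14 and Cor. 16 (the single-shot residual-error bound).
-/

namespace Literature.InformationTheory.QuantumCodes

namespace QuantumExpander

open Finset Matrix

variable {A B : Type*} [Fintype A] [Fintype B] [DecidableEq A] [DecidableEq B]

/-- In `𝔽₂` a non-zero element is `1`. [folklore] -/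
private theorem zmod2_eq_one_of_ne_zero' {z : ZMod 2} (h : z ≠ 0) : z = 1 := by
  revert z; decide

/-- In `𝔽₂`, `z + z = 0`. [folklore] -/
private theorem zmod2_add_self (z : ZMod 2) : z + z = 0 := by
  revert z; decide

omit [DecidableEq A] [DecidableEq B] in
/-- `|supp e| = |e|`. [folklore] -/
private theorem card_supp' (e : (A × A) ⊕ (B × B) → ZMod 2) : (supp e).card = hammingNorm e := by
  simp [supp, hammingNorm]

/-! ### Lemma 17: subsets of (`‖·‖`-)reduced errors are (`‖·‖`-)reduced -/

omit [DecidableEq A] [DecidableEq B] in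
/-- The weighted size as two Hamming weights: `Δ_AΔ_B‖E‖ = Δ_A|E ∩ A²| + Δ_B|E ∩ B²|`.
[cite: FawziGrospellierLeverrier2018FT, §3.3 (definition of ‖E‖; arXiv p0017 L1-4)] -/
theorem wnorm_eq_hammingNorm_parts (dA dB : ℕ) (e : (A × A) ⊕ (B × B) → ZMod 2) :
    wnorm dA dB e = dA * hammingNorm (fun p : A × A => e (Sum.inl p))
      + dB * hammingNorm (fun p : B × B => e (Sum.inr p)) := by
  simp [wnorm, hammingNorm]

/-- `Δ_AΔ_B(‖E₁ ⊕ E₂‖ + 2‖E₁ ∩ E₂‖) = Δ_AΔ_B(‖E₁‖ + ‖E₂‖)` — the printed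
"`‖E₁ ⊕ E₂‖ = ‖E₁‖ + ‖E₂‖ − 2‖E₁ ∩ E₂‖`", with the weighted intersection written out.
[cite: FawziGrospellierLeverrier2018FT, §3.3 (properties of ‖·‖; arXiv p0017 L6-12)] -/
theorem wnorm_add_add_two_mul_winter (dA dB : ℕ) (e u : (A × A) ⊕ (B × B) → ZMod 2) :
    wnorm dA dB (e + u)
      + 2 * (dA * ((univ.filter fun p : A × A => e (Sum.inl p) ≠ 0)
                ∩ (univ.filter fun p : A × A => u (Sum.inl p) ≠ 0)).card
            + dB * ((univ.filter fun p : B × B => e (Sum.inr p) ≠ 0)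
                ∩ (univ.filter fun p : B × B => u (Sum.inr p) ≠ 0)).card)
      = wnorm dA dB e + wnorm dA dB u := by
  have hA := SmallSetFlip.hammingNorm_add_add_two_mul_inter
    (fun p : A × A => e (Sum.inl p)) (fun p : A × A => u (Sum.inl p))
  have hB := SmallSetFlip.hammingNorm_add_add_two_mul_inter
    (fun p : B × B => e (Sum.inr p)) (fun p : B × B => u (Sum.inr p))
  simp only [hammingNorm, Pi.add_apply] at hA hB
  simp only [wnorm, Pi.add_apply]
  nlinarith [hA, hB]

/-- **FGL18b Lemma 17, `‖·‖` version (vector form).** If `E₁ ⊆ E₂` and `E₂` does not lose weighted size by adding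
`u` (`‖E₂‖ ≤ ‖E₂ ⊕ u‖`), then neither does `E₁`; hence a subset of a `‖·‖`-reduced error is `‖·‖`-reduced
("`0 ≤ ‖E₂ ⊕ E‖ − ‖E₂‖ = ‖E‖ − 2‖E₂ ∩ E‖ ≤ ‖E‖ − 2‖E₁ ∩ E‖ = ‖E₁ ⊕ E‖ − ‖E₁‖`").
[cite: FawziGrospellierLeverrier2018FT, Lemma 17 (arXiv p0017 L15-26)] -/
theorem wnorm_le_wnorm_add_of_subset (dA dB : ℕ) {e₁ e₂ u : (A × A) ⊕ (B × B) → ZMod 2}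
    (hsub : supp e₁ ⊆ supp e₂) (h : wnorm dA dB e₂ ≤ wnorm dA dB (e₂ + u)) :
    wnorm dA dB e₁ ≤ wnorm dA dB (e₁ + u) := by
  have h1 := wnorm_add_add_two_mul_winter dA dB e₁ u
  have h2 := wnorm_add_add_two_mul_winter dA dB e₂ u
  have hAle : ((univ.filter fun p : A × A => e₁ (Sum.inl p) ≠ 0)
        ∩ (univ.filter fun p : A × A => u (Sum.inl p) ≠ 0)).card
      ≤ ((univ.filter fun p : A × A => e₂ (Sum.inl p) ≠ 0)
        ∩ (univ.filter fun p : A × A => u (Sum.inl p) ≠ 0)).card := by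
    refine Finset.card_le_card (Finset.inter_subset_inter ?_ subset_rfl)
    intro p hp
    have : Sum.inl p ∈ supp e₁ := by simpa [supp] using hp
    have := hsub this
    simpa [supp] using this
  have hBle : ((univ.filter fun p : B × B => e₁ (Sum.inr p) ≠ 0)
        ∩ (univ.filter fun p : B × B => u (Sum.inr p) ≠ 0)).card
      ≤ ((univ.filter fun p : B × B => e₂ (Sum.inr p) ≠ 0)
        ∩ (univ.filter fun p : B × B => u (Sum.inr p) ≠ 0)).card := by
    refine Finset.card_le_card (Finset.inter_subset_inter ?_ subset_rfl)
    intro p hp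
    have : Sum.inr p ∈ supp e₁ := by simpa [supp] using hp
    have := hsub this
    simpa [supp] using this
  have hA' := Nat.mul_le_mul_left dA hAle
  have hB' := Nat.mul_le_mul_left dB hBle
  omega

/-- **FGL18b Lemma 17, Hamming version (vector form).** If `E₁ ⊆ E₂` and `|E₂| ≤ |E₂ ⊕ u|` then `|E₁| ≤ |E₁ ⊕ u|`;
hence a subset of a reduced error is reduced. [cite: FawziGrospellierLeverrier2018FT, Lemma 17 (arXiv p0017 L15-26)] -/
theorem hammingNorm_le_hammingNorm_add_of_subset {Q : Type*} [Fintype Q] [DecidableEq Q] {e₁ e₂ u : Q → ZMod 2}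
    (hsub : supp e₁ ⊆ supp e₂) (h : hammingNorm e₂ ≤ hammingNorm (e₂ + u)) :
    hammingNorm e₁ ≤ hammingNorm (e₁ + u) := by
  classical
  have h1 := SmallSetFlip.hammingNorm_add_add_two_mul_inter e₁ u
  have h2 := SmallSetFlip.hammingNorm_add_add_two_mul_inter e₂ u
  have hle : ((univ.filter fun q => e₁ q ≠ 0) ∩ (univ.filter fun q => u q ≠ 0)).card
      ≤ ((univ.filter fun q => e₂ q ≠ 0) ∩ (univ.filter fun q => u q ≠ 0)).card := by
    refine Finset.card_le_card (Finset.inter_subset_inter ?_ subset_rfl)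
    intro q hq
    have : q ∈ supp e₁ := by simpa [supp] using hq
    have := hsub this
    simpa [supp] using this
  omega

/-! ### The support after a flip inside the support -/

/-- Flipping a subset `F ⊆ E` of the error removes it: `supp(e ⊕ 𝟙_F) = E ∖ F`.
[cite: FawziGrospellierLeverrier2018FT, proof of Prop 14 / Lemma 15 ("E_{i+1} = E_i ⊕ F_i = E_i ∖ F_i"; arXiv p0018 L12-14)] -/
theorem supp_add_flipVec_of_subset {e : (A × A) ⊕ (B × B) → ZMod 2} {F : Finset ((A × A) ⊕ (B × B))}
    (hF : F ⊆ supp e) : supp (e + flipVec F) = supp e \ F := by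
  classical
  ext q
  rw [Finset.mem_sdiff]
  by_cases hq : q ∈ F
  · have he : e q = 1 := zmod2_eq_one_of_ne_zero' (by simpa [supp] using hF hq)
    simp [supp, flipVec, hq, he, zmod2_add_self]
  · simp [supp, flipVec, hq]

omit [Fintype A] [Fintype B] in
/-- `𝟙_F ⊕ 𝟙_F = 0`. [folklore] -/
private theorem flipVec_add_flipVec (F : Finset ((A × A) ⊕ (B × B))) : flipVec F + flipVec F = 0 := by
  funext q
  simp only [Pi.add_apply, Pi.zero_apply]
  exact zmod2_add_self _

/-- Weighted size splits over a flip inside the support: `Δ_AΔ_B‖E‖ = Δ_AΔ_B‖F‖ + Δ_AΔ_B‖E ∖ F‖` for `F ⊆ E`.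
[cite: FawziGrospellierLeverrier2018FT, §3.3 ("‖E₁ ⊎ E₂‖ = ‖E₁‖ + ‖E₂‖"; arXiv p0017 L10)] -/
theorem wnorm_eq_wnorm_flipVec_add {dA dB : ℕ} {e : (A × A) ⊕ (B × B) → ZMod 2}
    {F : Finset ((A × A) ⊕ (B × B))} (hF : F ⊆ supp e) :
    wnorm dA dB e = wnorm dA dB (flipVec F) + wnorm dA dB (e + flipVec F) := by
  classical
  -- `e = (e ⊕ 𝟙_F) ⊕ 𝟙_F`, and the two summands have disjoint supports
  have hdecomp : e = (e + flipVec F) + flipVec F := by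
    rw [add_assoc, flipVec_add_flipVec, add_zero]
  have hid := wnorm_add_add_two_mul_winter dA dB (e + flipVec F) (flipVec F)
  rw [← hdecomp] at hid
  have hsupp := supp_add_flipVec_of_subset hF
  have hA0 : ((univ.filter fun p : A × A => (e + flipVec F) (Sum.inl p) ≠ 0)
      ∩ (univ.filter fun p : A × A => flipVec F (Sum.inl p) ≠ 0)).card = 0 := by
    rw [Finset.card_eq_zero, Finset.eq_empty_iff_forall_notMem]
    intro p hp
    rw [Finset.mem_inter, Finset.mem_filter, Finset.mem_filter] at hp
    have h1 : Sum.inl p ∈ supp (e + flipVec F) := by simpa [supp] using hp.1.2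
    rw [hsupp, Finset.mem_sdiff] at h1
    have h2 : Sum.inl p ∈ F := by
      by_contra hn; exact hp.2.2 (by simp [flipVec, hn])
    exact h1.2 h2
  have hB0 : ((univ.filter fun p : B × B => (e + flipVec F) (Sum.inr p) ≠ 0)
      ∩ (univ.filter fun p : B × B => flipVec F (Sum.inr p) ≠ 0)).card = 0 := by
    rw [Finset.card_eq_zero, Finset.eq_empty_iff_forall_notMem]
    intro p hp
    rw [Finset.mem_inter, Finset.mem_filter, Finset.mem_filter] at hp
    have h1 : Sum.inr p ∈ supp (e + flipVec F) := by simpa [supp] using hp.1.2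
    rw [hsupp, Finset.mem_sdiff] at h1
    have h2 : Sum.inr p ∈ F := by
      by_contra hn; exact hp.2.2 (by simp [flipVec, hn])
    exact h1.2 h2
  rw [hA0, hB0] at hid
  omega

/-! ### Lemma 18: the flip of a critical generator, its syndrome weight and its decrease -/

/-- **The syndrome weight of the flip `F = x_a ⊎ x_b`** (FGL18b eq. (func analysis), cleared of denominators):
`|σ_X(F)| + 2|x_a||x_b| = Δ_A|x_a| + Δ_B|x_b| = Δ_AΔ_B‖F‖` — the checks `αβ` with `α ∈ X_a`, `β ∈ Γ(a) ∖ Y_b` and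
those with `α ∈ Γ(b) ∖ X_a`, `β ∈ Y_b` are hit exactly once ("`|σ_X(F)| = |x_a|(|x̄_b| + |χ_b|) + |x_b|(|x̄_a| + |χ_a|)`").
Only `X_a ⊆ Γ(b)`, `Y_b ⊆ Γ(a)` is used (true by definition of `critX`, `critY`).
[cite: FawziGrospellierLeverrier2018FT, Lemma 18 proof, eq. (func analysis) (arXiv p0017 L95-103)] -/
theorem hammingNorm_syndrome_critFlip (H : Matrix B A (ZMod 2)) {dA dB : ℕ} (hreg : IsBiregular H dA dB)
    (e : (A × A) ⊕ (B × B) → ZMod 2) (b : B) (a : A) (Χa : Finset A) (Χb : Finset B) :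
    hammingNorm (expanderHX H *ᵥ flipVec (critFlip H e b a Χa Χb))
        + 2 * ((critX H e b a Χa).card * (critY H e b a Χb).card)
      = dA * (critX H e b a Χa).card + dB * (critY H e b a Χb).card := by
  classical
  set Xa := critX H e b a Χa with hXa
  set Yb := critY H e b a Χb with hYb
  have hXsub : Xa ⊆ nbrs Hᵀ b := fun α hα =>
    (Finset.mem_sdiff.1 (Finset.mem_filter.1 hα).1).1
  have hYsub : Yb ⊆ nbrs H a := fun β hβ =>
    (Finset.mem_sdiff.1 (Finset.mem_filter.1 hβ).1).1
  have h11 : (1 : ZMod 2) + 1 = 0 := by decide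
  -- the support of `σ_X(F)` is the disjoint union of two "rectangles"
  have hsupp : (univ.filter fun c : A × B => (expanderHX H *ᵥ flipVec (critFlip H e b a Χa Χb)) c ≠ 0)
      = Xa ×ˢ (nbrs H a \ Yb) ∪ (nbrs Hᵀ b \ Xa) ×ˢ Yb := by
    ext ⟨α, β⟩
    rw [Finset.mem_filter, expanderHX_mulVec_flipVec_critFlip, Finset.mem_union, Finset.mem_product,
      Finset.mem_product, Finset.mem_sdiff, Finset.mem_sdiff, mem_nbrs, mem_nbrs, Matrix.transpose_apply]
    simp only [Finset.mem_univ, true_and]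
    rw [← hXa, ← hYb]
    by_cases hα : α ∈ Xa <;> by_cases hβ : β ∈ Yb
    · -- both: the check sees `αa` and `bβ`, value `1 + 1 = 0`
      have h1 : H β a = 1 := zmod2_eq_one_of_ne_zero' (mem_nbrs.1 (hYsub hβ))
      have h2 : H b α = 1 := by
        have := mem_nbrs.1 (hXsub hα); rw [Matrix.transpose_apply] at this
        exact zmod2_eq_one_of_ne_zero' this
      simp [hα, hβ, h1, h2, h11]
    · simp [hα, hβ]
    · simp [hα, hβ]
    · simp [hα, hβ]
  have hdisj : Disjoint (Xa ×ˢ (nbrs H a \ Yb)) ((nbrs Hᵀ b \ Xa) ×ˢ Yb) := by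
    rw [Finset.disjoint_left]
    rintro ⟨α, β⟩ h1 h2
    rw [Finset.mem_product] at h1 h2
    exact (Finset.mem_sdiff.1 h2.1).2 h1.1
  have hcard : hammingNorm (expanderHX H *ᵥ flipVec (critFlip H e b a Χa Χb))
      = Xa.card * (dA - Yb.card) + (dB - Xa.card) * Yb.card := by
    unfold hammingNorm
    rw [hsupp, Finset.card_union_of_disjoint hdisj, Finset.card_product, Finset.card_product,
      Finset.card_sdiff_of_subset hYsub, Finset.card_sdiff_of_subset hXsub, card_nbrs_eq H hreg a,
      card_nbrs_transpose_eq H hreg b]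
  have hYle : Yb.card ≤ dA := by
    have := Finset.card_le_card hYsub; rwa [card_nbrs_eq H hreg a] at this
  have hXle : Xa.card ≤ dB := by
    have := Finset.card_le_card hXsub; rwa [card_nbrs_transpose_eq H hreg b] at this
  rw [hcard]
  zify [hYle, hXle]
  ring

/-- The weighted size of the flip: `Δ_AΔ_B‖x_a ⊎ x_b‖ = Δ_A|x_a| + Δ_B|x_b|` (`x_a ⊆ A²`, `x_b ⊆ B²`).
[cite: FawziGrospellierLeverrier2018FT, Lemma 18 proof ("‖F‖ = ‖x_a‖ + ‖x_b‖"; arXiv p0017 L104)] -/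
theorem wnorm_flipVec_critFlip (H : Matrix B A (ZMod 2)) (dA dB : ℕ) (e : (A × A) ⊕ (B × B) → ZMod 2)
    (b : B) (a : A) (Χa : Finset A) (Χb : Finset B) :
    wnorm dA dB (flipVec (critFlip H e b a Χa Χb))
      = dA * (critX H e b a Χa).card + dB * (critY H e b a Χb).card := by
  classical
  have hAset : (univ.filter fun p : A × A => flipVec (critFlip H e b a Χa Χb) (Sum.inl p) ≠ 0)
      = (critX H e b a Χa).image fun α => (α, a) := by
    ext ⟨α, a'⟩
    simp only [Finset.mem_filter, Finset.mem_univ, true_and, Finset.mem_image, flipVec,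
      inl_mem_critFlip, ne_eq, ite_eq_right_iff, one_ne_zero, imp_false, not_not, Prod.mk.injEq]
    constructor
    · rintro ⟨rfl, hα⟩; exact ⟨α, hα, rfl, rfl⟩
    · rintro ⟨α', hα', rfl, rfl⟩; exact ⟨rfl, hα'⟩
  have hBset : (univ.filter fun p : B × B => flipVec (critFlip H e b a Χa Χb) (Sum.inr p) ≠ 0)
      = (critY H e b a Χb).image fun β => (b, β) := by
    ext ⟨b', β⟩
    simp only [Finset.mem_filter, Finset.mem_univ, true_and, Finset.mem_image, flipVec,
      inr_mem_critFlip, ne_eq, ite_eq_right_iff, one_ne_zero, imp_false, not_not, Prod.mk.injEq]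
    constructor
    · rintro ⟨rfl, hβ⟩; exact ⟨β, hβ, rfl, rfl⟩
    · rintro ⟨β', hβ', rfl, rfl⟩; exact ⟨rfl, hβ'⟩
  unfold wnorm
  rw [hAset, hBset, Finset.card_image_of_injective, Finset.card_image_of_injective]
  · intro β β' h; simpa using h
  · intro α α' h; simpa using h

/-- **FGL18b Lemma 18 (= LTZ15 Lemma 8 revisited), local form.** At a critical generator `g_{ba}` for `E = supp e`
where the local `‖·‖`-minimality inequality `Δ_A|x_a| + Δ_B|x_b| ≤ Δ_AΔ_B` holds ("`‖x_a‖ + ‖x_b‖ ≤ 1` because `E`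
is `‖·‖`-reduced"), the flip `F = x_a ⊎ x_b ⊆ E` satisfies
(i) `Δ_AΔ_B‖F‖ ≤ 2|σ_X(F)|` ("`|σ_X(F)| ≥ ½ d_A d_B‖F‖`", so `F ∈ 𝓕`) and
(ii) `|σ_X(F)| − 4(δ_AΔ_A|x_a| + δ_BΔ_B|x_b|) ≤ Δ(σ_X(E), F)` (printed with one `δ`:
"`Δ(σ_X(E), F) ≥ |σ_X(F)| − 4δ d_A d_B‖F‖`", which follows since `Δ_A|x_a| + Δ_B|x_b| = Δ_AΔ_B‖F‖`).
Proof: (i) is `Δ_A X + Δ_B Y ≥ 4XY`, from `(Δ_A X + Δ_B Y)² ≥ 4Δ_AΔ_B XY` and the minimality inequality; (ii) is the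
tree's decrease inequality `syndromeDecrease_critFlip_ge` plus `|χ_a| ≤ 2δ_BΔ_B`, `|χ_b| ≤ 2δ_AΔ_A`.
[cite: FawziGrospellierLeverrier2018FT, Lemma 18 (arXiv p0017 L48-55) and its proof (p0017 L56 – p0018 L8)] -/
theorem fgl18b_lemma18 (H : Matrix B A (ZMod 2)) {dA dB : ℕ} {δA δB : ℝ} (hreg : IsBiregular H dA dB)
    {e : (A × A) ⊕ (B × B) → ZMod 2} {b : B} {a : A} {Χa : Finset A} {Χb : Finset B}
    (hc : IsCritical H dA dB δA δB (supp e) b a Χa Χb)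
    (hmin' : dA * (critX H e b a Χa).card + dB * (critY H e b a Χb).card ≤ dA * dB) :
    wnorm dA dB (flipVec (critFlip H e b a Χa Χb))
        ≤ 2 * hammingNorm (expanderHX H *ᵥ flipVec (critFlip H e b a Χa Χb)) ∧
      (hammingNorm (expanderHX H *ᵥ flipVec (critFlip H e b a Χa Χb)) : ℝ)
          - 4 * (δA * (dA * (critX H e b a Χa).card) + δB * (dB * (critY H e b a Χb).card))
        ≤ syndromeDecrease (expanderHX H) (expanderHX H *ᵥ e) (critFlip H e b a Χa Χb) := by
  have hsyn := hammingNorm_syndrome_critFlip H hreg e b a Χa Χb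
  have hw := wnorm_flipVec_critFlip H dA dB e b a Χa Χb
  have hYle : (critY H e b a Χb).card ≤ dA := by
    have hsub : critY H e b a Χb ⊆ nbrs H a := fun β hβ =>
      (Finset.mem_sdiff.1 (Finset.mem_filter.1 hβ).1).1
    have := Finset.card_le_card hsub; rwa [card_nbrs_eq H hreg a] at this
  have hXle : (critX H e b a Χa).card ≤ dB := by
    have hsub : critX H e b a Χa ⊆ nbrs Hᵀ b := fun α hα =>
      (Finset.mem_sdiff.1 (Finset.mem_filter.1 hα).1).1
    have := Finset.card_le_card hsub; rwa [card_nbrs_transpose_eq H hreg b] at this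
  set X := (critX H e b a Χa).card with hX
  set Y := (critY H e b a Χb).card with hY
  set s := hammingNorm (expanderHX H *ᵥ flipVec (critFlip H e b a Χa Χb)) with hs
  constructor
  · -- (i): `Δ_A X + Δ_B Y ≥ 4XY` under `Δ_A X + Δ_B Y ≤ Δ_AΔ_B`
    rw [hw]
    -- `4 Δ_AΔ_B XY ≤ (Δ_A X + Δ_B Y)² ≤ Δ_AΔ_B (Δ_A X + Δ_B Y)`
    have h4 : 4 * ((dA : ℤ) * dB) * (X * Y) ≤ (dA * X + dB * Y) * (dA * X + dB * Y) := by
      nlinarith [sq_nonneg ((dA : ℤ) * X - dB * Y)]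
    have h5 : ((dA : ℤ) * X + dB * Y) * (dA * X + dB * Y) ≤ (dA * dB) * (dA * X + dB * Y) := by
      have hm : ((dA * X + dB * Y : ℕ) : ℤ) ≤ ((dA * dB : ℕ) : ℤ) := by exact_mod_cast hmin'
      push_cast at hm
      have hnn : (0 : ℤ) ≤ dA * X + dB * Y := by positivity
      nlinarith
    by_cases hd : dA * dB = 0
    · -- degenerate degrees: `Δ_A = 0` forces `Y = 0`, `Δ_B = 0` forces `X = 0`
      rcases Nat.mul_eq_zero.1 hd with h0 | h0
      · have hY0 : Y = 0 := by rw [h0] at hYle; omega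
        rw [h0, hY0]; simp
      · have hX0 : X = 0 := by rw [h0] at hXle; omega
        rw [h0, hX0]; simp
    · have hpos : (0 : ℤ) < dA * dB := by
        have := Nat.pos_of_ne_zero hd; exact_mod_cast this
      have h6 : 4 * ((dA : ℤ) * dB) * (X * Y) ≤ (dA * dB) * (dA * X + dB * Y) := h4.trans h5
      have h7 : 4 * ((X : ℤ) * Y) ≤ dA * X + dB * Y := by
        by_contra hlt
        push Not at hlt
        have : ((dA : ℤ) * dB) * (dA * X + dB * Y) < ((dA : ℤ) * dB) * (4 * (X * Y)) :=
          mul_lt_mul_of_pos_left hlt hpos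
        linarith
      have hsZ : (s : ℤ) + 2 * (X * Y) = dA * X + dB * Y := by exact_mod_cast hsyn
      have : ((dA * X + dB * Y : ℕ) : ℤ) ≤ ((2 * s : ℕ) : ℤ) := by push_cast; linarith
      exact_mod_cast this
  · -- (ii): the decrease inequality of the tree, and `|χ_b| ≤ 2δ_AΔ_A`, `|χ_a| ≤ 2δ_BΔ_B`
    have hdec := syndromeDecrease_critFlip_ge hreg hc
    have hdecR : (X : ℝ) * ((dA : ℝ) - Χb.card - Y) + ((dB : ℝ) - Χa.card - X) * Y
        - X * Χb.card - Χa.card * Y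
        ≤ syndromeDecrease (expanderHX H) (expanderHX H *ᵥ e) (critFlip H e b a Χa Χb) := by
      rw [hX, hY]; exact_mod_cast hdec
    have hsR : (s : ℝ) + 2 * (X * Y) = dA * X + dB * Y := by exact_mod_cast hsyn
    have hXnn : (0 : ℝ) ≤ X := Nat.cast_nonneg _
    have hYnn : (0 : ℝ) ≤ Y := Nat.cast_nonneg _
    have hΧa := hc.card_Χa_le
    have hΧb := hc.card_Χb_le
    nlinarith [mul_le_mul_of_nonneg_left hΧb hXnn, mul_le_mul_of_nonneg_left hΧa hYnn]

/-! ### The critical decomposition `E₀ = ⊎ᵢ Fᵢ` (common beginning of the proofs of Prop. 14 and Lemma 15) -/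

/-- The local minimality inequality from `‖·‖`-minimality against ONE generator: if `‖E‖ ≤ ‖E ⊕ g_{ba}‖` then
`Δ_A|x_a| + Δ_B|x_b| ≤ Δ_AΔ_B` ("`‖x_a‖ + ‖x_b‖ ≤ 1` because `E` is `‖·‖`-reduced"; here `x_a`, `x_b` may even be
taken off any `Χa`, `Χb`). This RESTATES, for use on the Literature side, the venture lemma
`Summit.Ventures.QEC.Expanders.critX_critY_le_of_wnorm_le` (`QuantumExpanderProp11Projection.lean`; a Literature
module cannot import a Summits module) — same statement, same proof from `wnorm_add_row`.
[cite: FawziGrospellierLeverrier2018FT, Lemma 18 proof (arXiv p0017 L105-106)]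
[cite: FawziGrospellierLeverrier2018, Lemma 24 proof ("x + y ≤ 1 because E_R minimizes ‖·‖"; arXiv v2 p0018 L81)] -/
theorem critX_critY_le_of_wnorm_le_add_row (H : Matrix B A (ZMod 2)) {dA dB : ℕ} (hreg : IsBiregular H dA dB)
    (e : (A × A) ⊕ (B × B) → ZMod 2) (b : B) (a : A) (Χa : Finset A) (Χb : Finset B)
    (hloc : wnorm dA dB e ≤ wnorm dA dB (e + expanderHZ H (b, a))) :
    dA * (critX H e b a Χa).card + dB * (critY H e b a Χb).card ≤ dA * dB := by
  have hrow := wnorm_add_row H hreg e b a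
  have hXle : (critX H e b a Χa).card ≤ ((nbrs Hᵀ b).filter fun α => e (Sum.inl (α, a)) ≠ 0).card := by
    refine Finset.card_le_card fun α hα => ?_
    rw [mem_critX] at hα
    rw [Finset.mem_filter, mem_nbrs, Matrix.transpose_apply]
    exact ⟨hα.1.1, hα.2⟩
  have hYle : (critY H e b a Χb).card ≤ ((nbrs H a).filter fun β => e (Sum.inr (b, β)) ≠ 0).card := by
    refine Finset.card_le_card fun β hβ => ?_
    rw [mem_critY] at hβ
    rw [Finset.mem_filter, mem_nbrs]
    exact ⟨hβ.1.1, hβ.2⟩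
  have hX' := Nat.mul_le_mul_left dA hXle
  have hY' := Nat.mul_le_mul_left dB hYle
  linarith

/-- **The critical decomposition** (FGL18b, proof of Prop. 14 and Lemma 15, first paragraph, eqs. (E eq uplus F) and
(rewrite sigma)). For a `(Δ_A, Δ_B)`-biregular (`Δ ≥ 1`) `(γ_A, δ_A, γ_B, δ_B)`-expanding graph (`δ ≥ 0`) and a
`‖·‖`-REDUCED error `E₀` (weighted size minimal in `E₀ + C_Z^⊥`) with `|E₀| ≤ γ_A n_A`, `|E₀| ≤ γ_B n_B`, iterating
"take a critical generator for `Eᵢ` (LTZ15 Lemma 7), flip `Fᵢ = x_a ⊎ x_b ⊆ Eᵢ` (Lemma 18), `Eᵢ₊₁ = Eᵢ ∖ Fᵢ`" (licit: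
`Eᵢ ⊆ E₀` is `‖·‖`-reduced by Lemma 17 and not larger) ends at `∅` and yields a set `𝓛 = {F₀, …, F_{f'−1}}` of pairwise
disjoint small sets with: `⊕_{F ∈ 𝓛} 𝟙_F = 𝟙_{E₀}`; every `F ∈ 𝓛` lies in `E₀` and has `Δ_AΔ_B‖F‖ ≤ 2|σ_X(F)|`
(Lemma 18 (i)); `Σ_{F ∈ 𝓛} Δ_AΔ_B‖F‖ = Δ_AΔ_B‖E₀‖`; and eq. (rewrite sigma)
`Σ_{F ∈ 𝓛} (|σ_X(F)| − 4δ·Δ_AΔ_B‖F‖) ≤ |σ_X(E₀)|` with `δ = max(δ_A, δ_B)` (from Lemma 18 (ii), telescoping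
`|σ_X(E₀)| = Σᵢ Δ(σ_X(Eᵢ), Fᵢ)`). [cite: FawziGrospellierLeverrier2018FT, proof of Prop 14 / Lemma 15 (arXiv p0018 L10-27)] -/
theorem exists_critical_decomposition (H : Matrix B A (ZMod 2)) {dA dB : ℕ} {γA δA γB δB : ℝ}
    (hreg : IsBiregular H dA dB) (hexp : IsLeftRightExpanding H dA dB γA δA γB δB)
    (hdA : 0 < dA) (hdB : 0 < dB) (hδA : 0 ≤ δA) (hδB : 0 ≤ δB)
    (e : (A × A) ⊕ (B × B) → ZMod 2)
    (hred : ∀ u ∈ rowSpace (expanderHZ H), wnorm dA dB e ≤ wnorm dA dB (e + u))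
    (heA : (hammingNorm e : ℝ) ≤ γA * Fintype.card A) (heB : (hammingNorm e : ℝ) ≤ γB * Fintype.card B) :
    ∃ L : Finset (Finset ((A × A) ⊕ (B × B))),
      (∑ F ∈ L, flipVec F) = e ∧
      (∀ F ∈ L, F ∈ smallSets (expanderHZ H) ∧ F ⊆ supp e ∧
        wnorm dA dB (flipVec F) ≤ 2 * hammingNorm (expanderHX H *ᵥ flipVec F)) ∧
      (∑ F ∈ L, wnorm dA dB (flipVec F)) = wnorm dA dB e ∧
      (∑ F ∈ L, ((hammingNorm (expanderHX H *ᵥ flipVec F) : ℝ)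
          - 4 * max δA δB * wnorm dA dB (flipVec F))) ≤ hammingNorm (expanderHX H *ᵥ e) := by
  classical
  suffices h : ∀ n : ℕ, ∀ f : (A × A) ⊕ (B × B) → ZMod 2, hammingNorm f ≤ n →
      (∀ u ∈ rowSpace (expanderHZ H), wnorm dA dB f ≤ wnorm dA dB (f + u)) →
      (hammingNorm f : ℝ) ≤ γA * Fintype.card A → (hammingNorm f : ℝ) ≤ γB * Fintype.card B →
      ∃ L : Finset (Finset ((A × A) ⊕ (B × B))),
        (∑ F ∈ L, flipVec F) = f ∧
        (∀ F ∈ L, F ∈ smallSets (expanderHZ H) ∧ F ⊆ supp f ∧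
          wnorm dA dB (flipVec F) ≤ 2 * hammingNorm (expanderHX H *ᵥ flipVec F)) ∧
        (∑ F ∈ L, wnorm dA dB (flipVec F)) = wnorm dA dB f ∧
        (∑ F ∈ L, ((hammingNorm (expanderHX H *ᵥ flipVec F) : ℝ)
            - 4 * max δA δB * wnorm dA dB (flipVec F))) ≤ hammingNorm (expanderHX H *ᵥ f) by
    exact h _ e le_rfl hred heA heB
  -- the empty decomposition of the zero word
  have hzero : ∀ f : (A × A) ⊕ (B × B) → ZMod 2, f = 0 →
      ∃ L : Finset (Finset ((A × A) ⊕ (B × B))),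
        (∑ F ∈ L, flipVec F) = f ∧
        (∀ F ∈ L, F ∈ smallSets (expanderHZ H) ∧ F ⊆ supp f ∧
          wnorm dA dB (flipVec F) ≤ 2 * hammingNorm (expanderHX H *ᵥ flipVec F)) ∧
        (∑ F ∈ L, wnorm dA dB (flipVec F)) = wnorm dA dB f ∧
        (∑ F ∈ L, ((hammingNorm (expanderHX H *ᵥ flipVec F) : ℝ)
            - 4 * max δA δB * wnorm dA dB (flipVec F))) ≤ hammingNorm (expanderHX H *ᵥ f) := by
    intro f hf
    subst hf
    refine ⟨∅, by simp, by simp, by simp [wnorm], by simp⟩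
  intro n
  induction n with
  | zero =>
    intro f hf hredf hfA hfB
    exact hzero f (hammingNorm_eq_zero.1 (Nat.le_zero.1 hf))
  | succ n ih =>
    intro f hf hredf hfA hfB
    by_cases hf0 : f = 0
    · exact hzero f hf0
    -- a non-zero word: critical generator, flip, recurse
    have hne : (supp f).Nonempty := by
      rw [Finset.nonempty_iff_ne_empty]
      intro hempty
      apply hf0
      funext q
      by_contra hq
      have : q ∈ supp f := by simpa [supp] using hq
      rw [hempty] at this
      exact Finset.notMem_empty _ this
    have hcardA : ((supp f).card : ℝ) ≤ γA * Fintype.card A := by rw [card_supp']; exact hfA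
    have hcardB : ((supp f).card : ℝ) ≤ γB * Fintype.card B := by rw [card_supp']; exact hfB
    obtain ⟨b, a, Χa, Χb, hc⟩ := exists_isCritical H hreg hexp hdA hdB hδA hδB (supp f) hne hcardA hcardB
    have hmin' := critX_critY_le_of_wnorm_le_add_row H hreg f b a Χa Χb
      (hredf _ (expanderHZ_row_mem_rowSpace H b a))
    obtain ⟨h18i, h18ii⟩ := fgl18b_lemma18 H hreg hc hmin'
    have hwF := wnorm_flipVec_critFlip H dA dB f b a Χa Χb
    set F := critFlip H f b a Χa Χb with hFdef
    have hFsub : F ⊆ supp f := critFlip_subset_supp H f b a Χa Χb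
    have hFne : F.Nonempty := critFlip_nonempty hc
    have hFsmall : F ∈ smallSets (expanderHZ H) := critFlip_mem_smallSets hc
    set f' := f + flipVec F with hf'def
    have hsupp' : supp f' = supp f \ F := supp_add_flipVec_of_subset hFsub
    have hcard' : hammingNorm f' + F.card = hammingNorm f := by
      rw [← card_supp', ← card_supp', hsupp', Finset.card_sdiff_of_subset hFsub]
      have := Finset.card_le_card hFsub
      omega
    have hFpos : 0 < F.card := Finset.card_pos.2 hFne
    have hle' : hammingNorm f' ≤ n := by omega
    have hred' : ∀ u ∈ rowSpace (expanderHZ H), wnorm dA dB f' ≤ wnorm dA dB (f' + u) := fun u hu =>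
      wnorm_le_wnorm_add_of_subset dA dB (by rw [hsupp']; exact Finset.sdiff_subset) (hredf u hu)
    have hmono : (hammingNorm f' : ℝ) ≤ hammingNorm f := by exact_mod_cast (by omega : hammingNorm f' ≤ hammingNorm f)
    obtain ⟨L', hsum', hmem', hw', hσ'⟩ := ih f' hle' hred' (hmono.trans hfA) (hmono.trans hfB)
    have hFnot : F ∉ L' := by
      intro hFL
      have hsub := (hmem' F hFL).2.1
      rw [hsupp'] at hsub
      obtain ⟨q, hq⟩ := hFne
      exact (Finset.mem_sdiff.1 (hsub hq)).2 hq
    refine ⟨insert F L', ?_, ?_, ?_, ?_⟩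
    · rw [Finset.sum_insert hFnot, hsum', hf'def, add_comm f, ← add_assoc, flipVec_add_flipVec, zero_add]
    · intro G hG
      rw [Finset.mem_insert] at hG
      rcases hG with rfl | hG
      · exact ⟨hFsmall, hFsub, h18i⟩
      · obtain ⟨h1, h2, h3⟩ := hmem' G hG
        exact ⟨h1, h2.trans (by rw [hsupp']; exact Finset.sdiff_subset), h3⟩
    · rw [Finset.sum_insert hFnot, hw', ← wnorm_eq_wnorm_flipVec_add hFsub]
    · rw [Finset.sum_insert hFnot]
      -- the new term is at most `|σ_X(f)| − |σ_X(f')|`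
      have hσf' : expanderHX H *ᵥ f + expanderHX H *ᵥ flipVec F = expanderHX H *ᵥ f' := by
        rw [hf'def, Matrix.mulVec_add]
      have hdecR : (syndromeDecrease (expanderHX H) (expanderHX H *ᵥ f) F : ℝ)
          = (hammingNorm (expanderHX H *ᵥ f) : ℝ) - hammingNorm (expanderHX H *ᵥ f') := by
        rw [syndromeDecrease, hσf']
        push_cast
        ring
      have hmax : δA * (dA * ((critX H f b a Χa).card : ℝ)) + δB * (dB * ((critY H f b a Χb).card : ℝ))
          ≤ max δA δB * (wnorm dA dB (flipVec F) : ℝ) := by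
        rw [hwF]
        push_cast
        have h1 : δA * (dA * ((critX H f b a Χa).card : ℝ)) ≤ max δA δB * (dA * (critX H f b a Χa).card) :=
          mul_le_mul_of_nonneg_right (le_max_left _ _) (by positivity)
        have h2 : δB * (dB * ((critY H f b a Χb).card : ℝ)) ≤ max δA δB * (dB * (critY H f b a Χb).card) :=
          mul_le_mul_of_nonneg_right (le_max_right _ _) (by positivity)
        linarith
      rw [hdecR] at h18ii
      linarith

/-! ### Lemma 15 (Robustness) -/

/-- **FGL18b Lemma 15 (Robustness).** For a `(Δ_A, Δ_B)`-biregular (`Δ ≥ 1`) `(γ_A, δ_A, γ_B, δ_B)`-expanding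
graph (`δ ≥ 0`; `δ = max(δ_A, δ_B)`, `β₀ = 1 − 8δ`) and a REDUCED error `E_R` (`|E_R| ≤ |E_R ⊕ u|` for every
`u ∈ C_Z^⊥`) with `max Δ·|E_R| ≤ min Δ·min(γ_A n_A, γ_B n_B)` (the printed `|E_R| ≤ γ₀√n`, see the module
docstring), `|σ_X(E_R)| ≥ (β₀·min Δ/2)·|E_R|` (printed: `(β₀ d_A/2)|E_R|`, `d_A` the smaller degree). Proof as
printed: `|σ_X(E_R)| = |σ_X(E₀)| ≥ (β₀/2)Δ_AΔ_B‖E₀‖ ≥ (β₀ min Δ/2)|E₀| ≥ (β₀ min Δ/2)|E_R|` for the `‖·‖`-reduced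
representative `E₀` of `E_R + C_Z^⊥`, by the critical decomposition and Lemma 18. (No hypothesis `δ < 1/8` is
needed: for `β₀ ≤ 0` the bound is void.)
[cite: FawziGrospellierLeverrier2018FT, Lemma 15 (arXiv p0016 L88-95) and its proof (p0018 L10-33)] -/
theorem fgl18b_lemma15 (H : Matrix B A (ZMod 2)) {dA dB : ℕ} {γA δA γB δB : ℝ}
    (hreg : IsBiregular H dA dB) (hexp : IsLeftRightExpanding H dA dB γA δA γB δB)
    (hdA : 0 < dA) (hdB : 0 < dB) (hδA : 0 ≤ δA) (hδB : 0 ≤ δB)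
    {eR : (A × A) ⊕ (B × B) → ZMod 2}
    (hred : ∀ u ∈ rowSpace (expanderHZ H), hammingNorm eR ≤ hammingNorm (eR + u))
    (hw : ((max dA dB : ℕ) : ℝ) * hammingNorm eR
      ≤ ((min dA dB : ℕ) : ℝ) * min (γA * Fintype.card A) (γB * Fintype.card B)) :
    (1 - 8 * max δA δB) * ((min dA dB : ℕ) : ℝ) / 2 * hammingNorm eR
      ≤ hammingNorm (expanderHX H *ᵥ eR) := by
  classical
  set dm : ℕ := min dA dB with hdm
  set dM : ℕ := max dA dB with hdM
  have hdm0 : 0 < dm := lt_min hdA hdB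
  have hdm' : (0 : ℝ) < dm := by exact_mod_cast hdm0
  by_cases hβ0 : 1 - 8 * max δA δB ≤ 0
  · have h1 : (1 - 8 * max δA δB) * (dm : ℝ) / 2 * hammingNorm eR ≤ 0 := by
      have : 0 ≤ (dm : ℝ) / 2 * hammingNorm eR := by positivity
      nlinarith
    exact h1.trans (Nat.cast_nonneg _)
  push Not at hβ0
  -- the `‖·‖`-reduced representative `E₀` of the coset, with the same syndrome
  obtain ⟨e₀, he₀, hmin⟩ := exists_wnorm_min (expanderHZ H) (wnorm dA dB) eR
  have hred₀ : ∀ u ∈ rowSpace (expanderHZ H), wnorm dA dB e₀ ≤ wnorm dA dB (e₀ + u) := by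
    intro u hu
    refine hmin _ ?_
    have : e₀ + u - eR = (e₀ - eR) + u := by abel
    rw [this]
    exact Submodule.add_mem _ he₀ hu
  have hsyn : expanderHX H *ᵥ e₀ = expanderHX H *ᵥ eR := by
    have h0 := expanderHX_mulVec_eq_zero_of_mem_rowSpace H he₀
    rw [Matrix.mulVec_sub, sub_eq_zero] at h0
    exact h0
  -- `|E_R| ≤ |E₀|` (E_R is reduced) and `min Δ |E₀| ≤ Δ_AΔ_B‖E₀‖ ≤ Δ_AΔ_B‖E_R‖ ≤ max Δ |E_R|`
  have hRle0 : hammingNorm eR ≤ hammingNorm e₀ := by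
    have h := hred (e₀ - eR) he₀
    rwa [add_sub_cancel] at h
  have h1 : dm * hammingNorm e₀ ≤ wnorm dA dB e₀ := (hammingNorm_le_wnorm_minmax dA dB e₀).1
  have h2 : wnorm dA dB e₀ ≤ wnorm dA dB eR := hmin eR (by simp)
  have h3 : wnorm dA dB eR ≤ dM * hammingNorm eR := (hammingNorm_le_wnorm_minmax dA dB eR).2
  have hcard0 : (hammingNorm e₀ : ℝ) ≤ min (γA * Fintype.card A) (γB * Fintype.card B) := by
    have h4 : ((dm : ℝ) * hammingNorm e₀) ≤ dM * hammingNorm eR := by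
      exact_mod_cast h1.trans (h2.trans h3)
    exact le_of_mul_le_mul_left (h4.trans hw) hdm'
  obtain ⟨L, hsum, hmem, hwsum, hσ⟩ := exists_critical_decomposition H hreg hexp hdA hdB hδA hδB e₀ hred₀
    (hcard0.trans (min_le_left _ _)) (hcard0.trans (min_le_right _ _))
  -- termwise: `|σ_X(F)| − 4δ‖F‖ ≥ (1/2 − 4δ)‖F‖`
  have hterm : ∀ F ∈ L, (1 / 2 - 4 * max δA δB) * (wnorm dA dB (flipVec F) : ℝ)
      ≤ (hammingNorm (expanderHX H *ᵥ flipVec F) : ℝ) - 4 * max δA δB * wnorm dA dB (flipVec F) := by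
    intro F hF
    have h := (hmem F hF).2.2
    have h' : (wnorm dA dB (flipVec F) : ℝ) ≤ 2 * hammingNorm (expanderHX H *ᵥ flipVec F) := by
      exact_mod_cast h
    linarith
  have hsumle := Finset.sum_le_sum hterm
  rw [← Finset.mul_sum] at hsumle
  have hwsumR : (∑ F ∈ L, (wnorm dA dB (flipVec F) : ℝ)) = wnorm dA dB e₀ := by exact_mod_cast hwsum
  rw [hwsumR] at hsumle
  rw [← hsyn]
  have h1R : (dm : ℝ) * hammingNorm e₀ ≤ wnorm dA dB e₀ := by exact_mod_cast h1
  have hRle0R : (hammingNorm eR : ℝ) ≤ hammingNorm e₀ := by exact_mod_cast hRle0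
  have hpos : 0 < 1 / 2 - 4 * max δA δB := by linarith
  calc (1 - 8 * max δA δB) * (dm : ℝ) / 2 * hammingNorm eR
      = (1 / 2 - 4 * max δA δB) * (dm * hammingNorm eR) := by ring
    _ ≤ (1 / 2 - 4 * max δA δB) * (dm * hammingNorm e₀) := by
        exact mul_le_mul_of_nonneg_left (mul_le_mul_of_nonneg_left hRle0R hdm'.le) hpos.le
    _ ≤ (1 / 2 - 4 * max δA δB) * wnorm dA dB e₀ := mul_le_mul_of_nonneg_left h1R hpos.le
    _ ≤ ∑ F ∈ L, ((hammingNorm (expanderHX H *ᵥ flipVec F) : ℝ)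
          - 4 * max δA δB * wnorm dA dB (flipVec F)) := hsumle
    _ ≤ hammingNorm (expanderHX H *ᵥ e₀) := hσ

end QuantumExpander

end Literature.InformationTheory.QuantumCodes
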